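import Literature.Geometry.Symplectic.OrigamiMoserFirstOrder
import Literature.Geometry.Kaehler.FibrePrimitiveProductSmooth
import HarnessLib

/-!
# The origami Moser argument, IV: the Moser vector field on the collar `N × ℝ`

Fourth file of the proof of the named fact `Literature.Geometry.Symplectic.exists_origamiCollarNormalForm`
(Cannas da Silva–Guillemin–Woodward 2000, Thm. 1).  For a family of `2`-forms `Ω s` and a
`1`-form `μ` on the collar `N × ℝ` (model `(𝓡 3).prod 𝓘(ℝ, ℝ)`, model space `ℝ³ × ℝ`), the
**Moser vector field** is defined GLOBALLY and chart-free as the plain Moser vector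
`X_s(p) = X(Ω_s(p), μ(p)) ∈ T_p(N × ℝ) = ℝ³ × ℝ` of `OrigamiMoserLinear.lean` (zero where `Ω_s(p)`
is degenerate).  This file proves:

* product-chart facts on `N × ℝ` in every degree (`apply_eq_inChart_zero'`: the value of a form
  at `(n, t)` IS its representative in the chart at `(n, 0)` at `(φ n, t)`; `contDiff_fibreCurve`:
  `t ↦ Ω (n, t)` is `C^∞` for a smooth form);
* `tangentCoordChange_moserField` — **read in the chart at `x₀`, the field is the plain Moser
  vector of the chart representatives** (naturality `plainMoser_compContinuousLinearMap` under
  the tangent coordinate change, an isomorphism `tccEquiv`);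
* `contMDiffAt_moserField` — **smoothness criterion**: the field is a `C^∞` time-dependent
  vector field (a `C^∞` map `ℝ × (N × ℝ) → T(N × ℝ)`, the form consumed by the tree's flow
  theorem `exists_ambientIsotopy_of_timeDependent_of_isCompact`) at `(s₀, z)` as soon as, read in
  some chart at `x₀` containing `z`, it agrees near `(s₀, z)` with a `C^∞` function of
  `(s, φ_{x₀} z)` — the cancelled Moser vector near the zero section, the plain one elsewhere.

Everything here is proved; the definitions are explicit; no facts.

## References

* A. Cannas da Silva, V. Guillemin, C. Woodward, *On the unfolding of folded symplectic
  structures*, Math. Res. Lett. 7 (2000), proof of Thm. 1. [CannasGuilleminWoodward2000]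
* D. McDuff, D. Salamon, *Introduction to Symplectic Topology*, 3rd ed. (2017), §3.2.
  [McDuffSalamon2017]
-/

noncomputable section

open scoped Manifold ContDiff Topology Bundle
open Set Function Filter
open Literature.Geometry.Kaehler

namespace Literature.Geometry.Symplectic

namespace OrigamiMoser

local notation "E3" => EuclideanSpace ℝ (Fin 3)
local notation "F4" => EuclideanSpace ℝ (Fin 3) × ℝ
local notation "I34" => ModelWithCorners.prod (𝓡 3) 𝓘(ℝ, ℝ)

variable {N : Type*} [TopologicalSpace N] [ChartedSpace (EuclideanSpace ℝ (Fin 3)) N]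

/-! ### The product chart of `N × ℝ`, in every degree -/

/-- On `N × ℝ` the chart representative of a form at `(n, t)` is the one at `(n, 0)`
(definitionally). [folklore] -/
theorem inChart_prod_real_eq' {k : ℕ} (Ω : MForm I34 (N × ℝ) ℝ k) (n : N) (t : ℝ) :
    Ω.inChart (n, t) = Ω.inChart (n, (0 : ℝ)) := rfl

/-- The line `t ↦ (φ n, t)` lies in the target of the chart at `(n, 0)`. [folklore] -/
theorem mem_target_line (n : N) (t : ℝ) :
    ((extChartAt (𝓡 3) n n, t) : F4) ∈ (extChartAt I34 ((n, (0 : ℝ)) : N × ℝ)).target := by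
  rw [mem_extChartAt_prod_real_target]
  exact mem_extChartAt_target n

variable [IsManifold (𝓡 3) ∞ N]

/-- **A form on `N × ℝ` read in the chart at `(n, 0)` along the line over `n`**, every degree:
`Ω (n, t) = Ω.inChart (n, 0) (φ n, t)`. [folklore] -/
theorem apply_eq_inChart_zero' {k : ℕ} (Ω : MForm I34 (N × ℝ) ℝ k) (n : N) (t : ℝ) :
    Ω (n, t) = Ω.inChart (n, (0 : ℝ)) (extChartAt (𝓡 3) n n, t) := by
  have h := (MForm.inChart_apply_self Ω ((n, t) : N × ℝ)).symm
  rw [inChart_prod_real_eq' Ω n t, extChartAt_prod_real_apply] at h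
  exact h

omit [IsManifold (𝓡 3) ∞ N] in
/-- **The fibre curve** `t ↦ Ω (n, t)` of a form on `N × ℝ` over `n`, as a curve of forms on the
model `ℝ³ × ℝ` (the tangent spaces along the fibre are all the model space). [folklore] -/
def fibreCurve {k : ℕ} (Ω : MForm I34 (N × ℝ) ℝ k) (n : N) : ℝ → F4 [⋀^Fin k]→L[ℝ] ℝ :=
  fun t => Ω (n, t)

omit [IsManifold (𝓡 3) ∞ N] in
/-- The value of the fibre curve (definitional). [folklore] -/
theorem fibreCurve_apply {k : ℕ} (Ω : MForm I34 (N × ℝ) ℝ k) (n : N) (t : ℝ) :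
    fibreCurve Ω n t = Ω (n, t) := rfl

/-- **The fibre curve of a smooth form is smooth** (it is the smooth chart representative at
`(n, 0)` along the line `t ↦ (φ n, t)`). [folklore] -/
theorem contDiff_fibreCurve {k : ℕ} {Ω : MForm I34 (N × ℝ) ℝ k} (hΩ : IsSmoothForm Ω) (n : N) :
    ContDiff ℝ ∞ (fibreCurve Ω n) := by
  have hrep : ContDiffOn ℝ ∞ (Ω.inChart ((n, (0 : ℝ)) : N × ℝ))
      (extChartAt I34 ((n, (0 : ℝ)) : N × ℝ)).target := hΩ.contDiffOn_inChart _
  have hline : ContDiff ℝ ∞ fun t : ℝ => ((extChartAt (𝓡 3) n n, t) : F4) :=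
    contDiff_const.prodMk contDiff_id
  have heq : fibreCurve Ω n = fun t => Ω.inChart ((n, (0 : ℝ)) : N × ℝ) (extChartAt (𝓡 3) n n, t) := by
    funext t; exact apply_eq_inChart_zero' Ω n t
  rw [heq, contDiff_iff_contDiffAt]
  intro t
  exact (hrep.contDiffAt ((isOpen_extChartAt_target _).mem_nhds (mem_target_line n t))).comp t
    hline.contDiffAt

/-! ### The tangent coordinate change as an isomorphism -/

/-- The tangent coordinate change `τ(x₀ → z)` at a point `z` of the chart source at `x₀`, as a
continuous linear equivalence (inverse `τ(z → x₀)`). [folklore] -/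
def tccEquiv (x₀ z : N × ℝ) (hz : z ∈ (extChartAt I34 x₀).source) : F4 ≃L[ℝ] F4 :=
  ContinuousLinearEquiv.equivOfInverse (tangentCoordChange I34 x₀ z z) (tangentCoordChange I34 z x₀ z)
    (fun v => by
      rw [tangentCoordChange_comp ⟨⟨hz, mem_extChartAt_source z⟩, hz⟩]
      exact tangentCoordChange_self hz)
    (fun v => by
      rw [tangentCoordChange_comp ⟨⟨mem_extChartAt_source z, hz⟩, mem_extChartAt_source z⟩]
      exact tangentCoordChange_self (mem_extChartAt_source z))

/-- The underlying map of `tccEquiv`. [folklore] -/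
theorem coe_tccEquiv (x₀ z : N × ℝ) (hz : z ∈ (extChartAt I34 x₀).source) :
    (tccEquiv x₀ z hz : F4 →L[ℝ] F4) = tangentCoordChange I34 x₀ z z := rfl

/-- The inverse of `tccEquiv`. [folklore] -/
theorem tccEquiv_symm_apply (x₀ z : N × ℝ) (hz : z ∈ (extChartAt I34 x₀).source) (v : F4) :
    (tccEquiv x₀ z hz).symm v = tangentCoordChange I34 z x₀ z v := rfl

/-! ### The Moser vector field -/

section Field

variable (Ω : ℝ → MForm I34 (N × ℝ) ℝ 2) (μ : MForm I34 (N × ℝ) ℝ 1)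

omit [IsManifold (𝓡 3) ∞ N] in
/-- **The Moser vector field** of the family `Ω s` and the `1`-form `μ`: at `p`, the plain Moser
vector of `(Ω s p, μ p)` in `T_p(N × ℝ) = ℝ³ × ℝ`. [cite: CannasGuilleminWoodward2000, proof of Thm. 1] -/
def moserField (s : ℝ) (p : N × ℝ) : TangentSpace I34 p := plainMoser (Ω s p) (μ p)

omit [IsManifold (𝓡 3) ∞ N] in
/-- Where `Ω s p` is degenerate the field vanishes. [folklore] -/
theorem moserField_eq_zero {s : ℝ} {p : N × ℝ} (h : pfF (Ω s p) = 0) : moserField Ω μ s p = 0 :=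
  plainMoser_eq_zero h _

omit [IsManifold (𝓡 3) ∞ N] in
/-- **The Moser equation** `Ω_s(X_s, u) = -μ(u)` where `Ω s p` is non-degenerate.
[cite: McDuffSalamon2017, §3.2] -/
theorem apply_moserField {s : ℝ} {p : N × ℝ} (h : pfF (Ω s p) ≠ 0) (u : F4) :
    Ω s p ![moserField Ω μ s p, u] = -(μ p ![u]) :=
  plainMoser_solves h _ u

/-- **The field read in the chart at `x₀` is the plain Moser vector of the representatives.**
[cite: McDuffSalamon2017, §3.2] -/
theorem tangentCoordChange_moserField (x₀ : N × ℝ) (s : ℝ) {z : N × ℝ}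
    (hz : z ∈ (extChartAt I34 x₀).source) :
    tangentCoordChange I34 z x₀ z (moserField Ω μ s z) =
      plainMoser ((Ω s).inChart x₀ (extChartAt I34 x₀ z)) (μ.inChart x₀ (extChartAt I34 x₀ z)) := by
  have hq : extChartAt I34 x₀ z ∈ (extChartAt I34 x₀).target := (extChartAt I34 x₀).map_source hz
  have hzq : (extChartAt I34 x₀).symm (extChartAt I34 x₀ z) = z := (extChartAt I34 x₀).left_inv hz
  have h1 : (Ω s).inChart x₀ (extChartAt I34 x₀ z) =
      (Ω s z).compContinuousLinearMap (tccEquiv x₀ z hz : F4 →L[ℝ] F4) := by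
    rw [MForm.inChart_eq_of_mem_target _ hq, hzq]; rfl
  have h2 : μ.inChart x₀ (extChartAt I34 x₀ z) =
      (μ z).compContinuousLinearMap (tccEquiv x₀ z hz : F4 →L[ℝ] F4) := by
    rw [MForm.inChart_eq_of_mem_target _ hq, hzq]; rfl
  rw [h1, h2]
  symm
  exact plainMoser_compContinuousLinearMap (Ω s z) (μ z) (tccEquiv x₀ z hz)

/-- **Smoothness criterion for the Moser field.** If, read in the chart at `x₀` (as
`τ(y → x₀)(X_s(y))`), the field agrees near `(s₀, z)` with a function `V̂ (s, φ_{x₀} y)` that is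
`C^∞` at `(s₀, φ_{x₀} z)`, then the field is a `C^∞` time-dependent vector field at `(s₀, z)`
(smoothness into the tangent bundle, tested in the trivialization at `x₀`).
[cite: McDuffSalamon2017, §3.2] -/
theorem contMDiffAt_moserField (x₀ : N × ℝ) {s₀ : ℝ} {z : N × ℝ}
    (hz : z ∈ (extChartAt I34 x₀).source) {V : ℝ × F4 → F4}
    (hV : ContDiffAt ℝ ∞ V (s₀, extChartAt I34 x₀ z))
    (heq : ∀ᶠ y in 𝓝 ((s₀, z) : ℝ × (N × ℝ)),
      tangentCoordChange I34 y.2 x₀ y.2 (moserField Ω μ y.1 y.2) = V (y.1, extChartAt I34 x₀ y.2)) :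
    ContMDiffAt (𝓘(ℝ, ℝ).prod I34) (ModelWithCorners.tangent I34) ∞
      (fun y : ℝ × (N × ℝ) => (⟨y.2, moserField Ω μ y.1 y.2⟩ : TangentBundle I34 (N × ℝ))) (s₀, z) := by
  set e := trivializationAt F4 (TangentSpace I34) x₀ with he
  have hsrc : (⟨z, moserField Ω μ s₀ z⟩ : TangentBundle I34 (N × ℝ)) ∈ e.source := by
    rw [he, Bundle.Trivialization.mem_source, TangentBundle.trivializationAt_baseSet,
      ← extChartAt_source I34]
    exact hz
  show ContMDiffAt (𝓘(ℝ, ℝ).prod I34) ((I34).prod 𝓘(ℝ, F4)) ∞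
    (fun y : ℝ × (N × ℝ) => (⟨y.2, moserField Ω μ y.1 y.2⟩ : TangentBundle I34 (N × ℝ))) (s₀, z)
  rw [e.contMDiffAt_iff
    (f := fun y : ℝ × (N × ℝ) => (⟨y.2, moserField Ω μ y.1 y.2⟩ : TangentBundle I34 (N × ℝ)))
    (x₀ := (s₀, z)) hsrc]
  refine ⟨contMDiffAt_snd, ?_⟩
  have hev : (fun y : ℝ × (N × ℝ) => (e ⟨y.2, moserField Ω μ y.1 y.2⟩).2) =ᶠ[𝓝 (s₀, z)]
      fun y => V (y.1, extChartAt I34 x₀ y.2) := by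
    filter_upwards [heq] with y hy
    rw [he, TangentBundle.trivializationAt_apply]
    exact hy
  refine ContMDiffAt.congr_of_eventuallyEq ?_ hev
  have h1 : ContMDiffAt (𝓘(ℝ, ℝ).prod I34) 𝓘(ℝ, ℝ × F4) ∞
      (fun y : ℝ × (N × ℝ) => (y.1, extChartAt I34 x₀ y.2)) (s₀, z) :=
    contMDiffAt_fst.prodMk_space ((contMDiffAt_extChartAt' (x := x₀)
      (by rwa [← extChartAt_source I34])).comp _ contMDiffAt_snd)
  exact ContDiffAt.comp_contMDiffAt (f := fun y : ℝ × (N × ℝ) => (y.1, extChartAt I34 x₀ y.2))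
    (x := (s₀, z)) hV h1

end Field

end OrigamiMoser

end Literature.Geometry.Symplectic

end
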